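import Summits.Langlands.Langlands.Theorems.IrreducibilityBySelfDualityReciprocityUpToIrreducibilityRankOneLocalComponent
import HarnessLib

/-!
# Line `Sketch` for the crux `ReciprocityUpToIrreducibility` (item stmt-Langlands-14328), continuation c7:
# stub S-E — the local component of a `GL₁` character datum is `θ_v ∘ det` at every place (uniqueness)

Support file (closes nothing; registered stub `stub_glOne_localComponent_unique` of the checked
skeleton `Lines/Sketch.lean`, wave N7 of continuation lead c7, prover-line-stmt-Langlands-14328-c7-0).

Statement (`stub_glOne_localComponent_unique`): let `π = W/W'` be a Borel–Jacquet datum of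
`GL₁(𝔸_K)` on which `GL₁(𝔸_K)` acts through the Hecke character `θ ∘ det` modulo `W'`
(`R(g) φ - θ(det g) φ ∈ W'` for `φ ∈ W`), `v` ANY finite place (ramified for `θ` or not) and `π_v`
ANY irreducible smooth local component of `π` at `v` (`AutomorphicRepData.HasLocalComponentAt`:
an `f : V →ₗ (GL₁(𝔸_K) → ℂ)` with `range f ≤ W`, `range f ≰ W'`,
`f (π_v(g) x) - R(ι_v g)(f x) ∈ W'`).  Then `π_v(g) x = θ_v(det g) • x` on `V`, where
`θ_v = θ ∘ (K_vˣ ↪ 𝕀_K)` is the local component (`HeckeCharacter.localComponent`).  Together with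
the existence half `hasLocalComponentAt_ofQuasiChar` (c4) this is Flath's theorem in rank one for
character data, at ramified places too.

Proof (`localComponent_ρ_apply_eq_of_hasLocalComponentAt`): an irreducible smooth `π_v` of
`GL₁(K_v)` is a line acting through its quasi-character `χ = IrrClass.quasiChar [π_v]`
(`IrrClass.quasiChar_spec`: `π_v(g) y = χ(det g) • y`; `K_v` is a non-archimedean local field,
`AdicCompletionLocalField`).  Pick `x₀` with `f x₀ ∉ W'`.  Modulo `W'`,
`χ(det g) • f x₀ ≡ f (π_v(g) x₀) ≡ R(ι_v g)(f x₀) ≡ θ(det (ι_v g)) • f x₀ = θ_v(det g) • f x₀`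
(`GLn.det_ofLocal`: `det (ι_v g) = (det g)_v`, `HeckeCharacter.localComponent_apply`), so
`(χ(det g) - θ_v(det g)) • f x₀ ∈ W'`, forcing `χ(det g) = θ_v(det g)` in `ℂ`
(`quasiChar_det_eq_localComponent_of_hasLocalComponentAt`); substitute in `quasiChar_spec`.
No definitions; std axioms; no named fact assumed.
-/

noncomputable section

set_option linter.dupNamespace false -- project-wide option (lakefile weak.linter.dupNamespace); `Summit.Langlands.Langlands` is the mandated namespace

open scoped MatrixGroups Matrix NumberField Classical
open Filter IsDedekindDomain Field
open Literature.NumberTheory.Automorphic Literature.NumberTheory.GaloisRepresentations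
open Literature.NumberTheory.PAdicHodge
open Summit.Langlands

namespace Summit.Langlands.Langlands.Theorems.ReciprocityUpToIrreducibility

section RankOne

variable {K : Type} [Field K] [NumberField K] {hcpt : isCompact_glFiniteIntegralLevel 1 K}

/-- **The quasi-character of a local component of a `GL₁` character datum is `θ_v`** (values in
`ℂ`, at `det g`).  If `GL₁(𝔸_K)` acts on `π = W/W'` through `θ ∘ det` modulo `W'` and the
irreducible smooth `π_v` is a local component of `π` at `v`, then the quasi-character
`χ = IrrClass.quasiChar [π_v]` through which `π_v` acts (`IrrClass.quasiChar_spec`) satisfies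
`χ(det g) = θ_v(det g)`: for `x₀` with `f x₀ ∉ W'`,
`(χ(det g) - θ_v(det g)) • f x₀ = [f (π_v(g) x₀) - R(ι_v g)(f x₀)] + [R(ι_v g)(f x₀) - θ(det ι_v g) • f x₀] ∈ W'`
(`GLn.det_ofLocal`, `HeckeCharacter.localComponent_apply`), and `W'` is a subspace.
[cite: FlathCorvallis1979, Thm. 3] [cite: BorelJacquetCorvallis1979, §4.6] -/
theorem quasiChar_det_eq_localComponent_of_hasLocalComponentAt
    (π : AutomorphicRepData (AutomorphyDatum.gl 1 K hcpt)) (θ : HeckeCharacter K)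
    (hact : ∀ (g : (AdelicGroupData.gl 1 K).Adelic), ∀ φ ∈ π.W,
      rightTranslation (AdelicGroupData.gl 1 K) g φ -
        ((θ (Matrix.GeneralLinearGroup.det g) : ℂˣ) : ℂ) • φ ∈ π.W')
    (v : HeightOneSpectrum (𝓞 K)) (πv : SmoothIrrep (GL (Fin 1) (v.adicCompletion K)))
    (h : π.HasLocalComponentAt v πv.ρ) (g : GL (Fin 1) (v.adicCompletion K)) :
    ((IrrClass.quasiChar (IrrClass.mk πv) (Matrix.GeneralLinearGroup.det g) : ℂˣ) : ℂ) =
      ((θ.localComponent v (Matrix.GeneralLinearGroup.det g) : ℂˣ) : ℂ) := by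
  obtain ⟨f, hW, hW', hf⟩ := h
  obtain ⟨y, hy, hy'⟩ := Set.not_subset.mp hW'
  obtain ⟨x₀, rfl⟩ := LinearMap.mem_range.mp hy
  -- `χ(det g) • f x₀ - R(ι_v g)(f x₀) ∈ W'`
  have h1 := hf g x₀
  rw [IrrClass.quasiChar_spec πv g x₀, map_smul] at h1
  -- `R(ι_v g)(f x₀) - θ_v(det g) • f x₀ ∈ W'`
  have h2 := hact (GLn.ofLocal 1 K v g) (f x₀) (hW (LinearMap.mem_range_self f x₀))
  rw [GLn.det_ofLocal, ← HeckeCharacter.localComponent_apply] at h2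
  have h3 := π.W'.add_mem h1 h2
  rw [sub_add_sub_cancel, ← sub_smul] at h3
  by_contra hne
  exact hy' ((π.W'.smul_mem_iff (sub_ne_zero.2 hne)).1 h3)

/-- **The local component of a `GL₁` character datum is `θ_v ∘ det` (uniqueness, Flath in rank
one for character data, every place).**  If `GL₁(𝔸_K)` acts on `π = W/W'` through `θ ∘ det`
modulo `W'` and the irreducible smooth `π_v` is ANY local component of `π` at the finite place `v`
(`AutomorphicRepData.HasLocalComponentAt`), then `π_v(g) x = θ_v(det g) • x` for all `g`, `x`:
`π_v` acts through its quasi-character `χ ∘ det` (`IrrClass.quasiChar_spec`) and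
`χ(det g) = θ_v(det g)` (`quasiChar_det_eq_localComponent_of_hasLocalComponentAt`).
[cite: FlathCorvallis1979, Thm. 3] [cite: BorelJacquetCorvallis1979, §4.6] -/
theorem localComponent_ρ_apply_eq_of_hasLocalComponentAt
    (π : AutomorphicRepData (AutomorphyDatum.gl 1 K hcpt)) (θ : HeckeCharacter K)
    (hact : ∀ (g : (AdelicGroupData.gl 1 K).Adelic), ∀ φ ∈ π.W,
      rightTranslation (AdelicGroupData.gl 1 K) g φ -
        ((θ (Matrix.GeneralLinearGroup.det g) : ℂˣ) : ℂ) • φ ∈ π.W')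
    (v : HeightOneSpectrum (𝓞 K)) (πv : SmoothIrrep (GL (Fin 1) (v.adicCompletion K)))
    (h : π.HasLocalComponentAt v πv.ρ) (g : GL (Fin 1) (v.adicCompletion K)) (x : πv.V) :
    πv.ρ g x = ((θ.localComponent v (Matrix.GeneralLinearGroup.det g) : ℂˣ) : ℂ) • x := by
  rw [IrrClass.quasiChar_spec πv g x,
    quasiChar_det_eq_localComponent_of_hasLocalComponentAt π θ hact v πv h g]

end RankOne

/-- **Registered stub `stub_glOne_localComponent_unique` of line `Sketch` (crux stmt-Langlands-14328,
c7 wave N7): the local component of a `GL₁` character datum is `θ_v ∘ det` at EVERY place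
(uniqueness).**  If `GL₁(𝔸_K)` acts on `π = W/W'` through `θ ∘ det` modulo `W'` and `π_v` is ANY
irreducible smooth local component of `π` at `v` (`HasLocalComponentAt`: `f : V → W`,
`range f ≰ W'`, `f(π_v(g) x) - R(ι_v g)(f x) ∈ W'`), then `π_v(g) = θ_v(det g)` on `V`
(`localComponent_ρ_apply_eq_of_hasLocalComponentAt`: `π_v` is a line acting through a
quasi-character `χ ∘ det`, and `(χ(det g) - θ_v(det g)) • f x₀ ∈ W'` for some `f x₀ ∉ W'` because
`det (ι_v g) = (det g)_v`, `GLn.det_ofLocal`, `HeckeCharacter.localComponent_apply`).  With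
`hasLocalComponentAt_ofQuasiChar` (existence, c4) this is Flath's theorem in rank one for character
data, at ramified places too. [cite: FlathCorvallis1979, Thm. 3] [cite: BorelJacquetCorvallis1979, §4.6] -/
theorem stub_glOne_localComponent_unique :
    ∀ (K : Type) [Field K] [NumberField K] (hcpt : isCompact_glFiniteIntegralLevel 1 K)
      (π : AutomorphicRepData (AutomorphyDatum.gl 1 K hcpt)) (θ : HeckeCharacter K),
      (∀ (g : (AdelicGroupData.gl 1 K).Adelic), ∀ φ ∈ π.W,
        rightTranslation (AdelicGroupData.gl 1 K) g φ -
          ((θ (Matrix.GeneralLinearGroup.det g) : ℂˣ) : ℂ) • φ ∈ π.W') →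
      ∀ (v : HeightOneSpectrum (𝓞 K)) (πv : SmoothIrrep (GL (Fin 1) (v.adicCompletion K))),
        π.HasLocalComponentAt v πv.ρ →
        ∀ (g : GL (Fin 1) (v.adicCompletion K)) (x : πv.V),
          πv.ρ g x = ((θ.localComponent v (Matrix.GeneralLinearGroup.det g) : ℂˣ) : ℂ) • x :=
  fun _K _ _ _hcpt π θ hact v πv h g x =>
    localComponent_ρ_apply_eq_of_hasLocalComponentAt π θ hact v πv h g x

end Summit.Langlands.Langlands.Theorems.ReciprocityUpToIrreducibility

end
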